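import Summits.ResolutionOfSingularities.ResolutionOfSingularities.Theorems.FrobeniusClosingDefs
import Literature.AlgebraicGeometry.Resolution.MvPowerSeriesChainRule
import Literature.AlgebraicGeometry.Resolution.PowerSeriesPBasis
import Literature.RingTheory.TwoVariableSeries.Basic
import Literature.RingTheory.MvPowerSeries.MaximalIdealPow

/-!
# Route `FrobeniusClosing`, crux `ClosingReduction`, line `chart-factorization`: stub `PairIsoKit`

`PairIsoKit` (stated in `Theorems/FrobeniusClosingDefs.lean`): over a field `K` of characteristic
`p` (`p` prime, `n ≥ 1`) the pair-isomorphism relation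
`PairIso p n K c c' := ∃ φ v g, IsUnit v ∧ φ (ser c) = v ^ p * ser c' + g ^ p`
(`φ` a `K`-algebra automorphism of `K⟦u₁, …, uₙ⟧`) is symmetric and transitive, and `Isol`,
`MultP` and every Loewy bound `JacPow β` are invariant under it.

Proof (all elementary, `R = K⟦u⟧` has characteristic `p`):
* symmetry / transitivity: Frobenius bookkeeping `(x + y)^p = x^p + y^p`, `φ (x^p) = (φ x)^p`;
* the Jacobian ideal is transported, `(jac c).map φ = jac c'`: the chain rule for the
  automorphism `φ` (`φ f = f(φ u₁, …, φ uₙ)`, `Jets.algHom_apply_eq_subst`, and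
  `MvPowerSeries.pderiv_subst`) gives `(span ∂f).map φ = span ∂(φ f)`, and
  `∂ᵢ (v^p a' + g^p) = v^p ∂ᵢ a'` because `∂ᵢ` is a derivation and `p = 0` in `R`;
  hence `R ⧸ jac c ≃ₐ[K] R ⧸ jac c'` (`Isol`) and
  `𝔪^β ≤ jac c → 𝔪^β = φ(𝔪^β) ≤ jac c'` (`JacPow`);
* `MultP` (the cleaned series is non-zero of order `≥ p`): a `p`-th power has only `p`-divisible
  exponents and a cleaned series none, so `ser c' = 0` would force `ser c = (φ⁻¹ g)^p = 0`; and a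
  coefficient of `ser c'` of degree `< p` would survive in `v^p ser c' + g^p = φ (ser c) ∈ 𝔪^p`.

Helper lemmas live in the sub-namespace `PairIsoKitProof`.
-/

noncomputable section

-- single-problem summit: the doubled namespace component is forced
set_option linter.dupNamespace false

open scoped BigOperators Classical

namespace Summit.ResolutionOfSingularities.ResolutionOfSingularities.Theorems.FrobeniusClosing

namespace PairIsoKitProof

open MvPowerSeries Literature.AlgebraicGeometry.Resolution Literature.RingTheory.MvPowerSeries.Jets

variable {p n : ℕ} {K : Type} [Field K]

/-! ### Frobenius bookkeeping in `K⟦u⟧` -/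

/-- `K⟦u₁, …, uₙ⟧` has characteristic `p` when `K` has. [folklore] -/
theorem charP_series (p : ℕ) [CharP K p] : CharP (MvPowerSeries (Fin n) K) p :=
  Literature.RingTheory.TwoVariableSeries.charP_mvPowerSeries (Fin n) p

/-- `(-x)^p = -(x^p)` in characteristic `p`. [folklore] -/
theorem neg_pow_p (hp : p.Prime) [CharP K p] (x : MvPowerSeries (Fin n) K) :
    (-x) ^ p = -(x ^ p) := by
  haveI := Fact.mk hp
  haveI := charP_series (n := n) (K := K) p
  rw [neg_pow, neg_one_pow_char, neg_one_mul]

/-- `(x + y)^p = x^p + y^p` in characteristic `p`. [folklore] -/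
theorem add_pow_p (hp : p.Prime) [CharP K p] (x y : MvPowerSeries (Fin n) K) :
    (x + y) ^ p = x ^ p + y ^ p := by
  haveI := Fact.mk hp
  haveI := charP_series (n := n) (K := K) p
  exact add_pow_char _ _ _

/-! ### Symmetry and transitivity of `PairIso` -/

/-- `PairIso` is symmetric: from `φ a = v^p a' + g^p` one gets
`φ⁻¹ a' = (φ⁻¹ v⁻¹)^p a + (-(φ⁻¹ (v⁻¹ g)))^p`. [folklore] -/
theorem pairIso_symm (hp : p.Prime) [CharP K p] {c c' : (Fin n → ℕ) → K}
    (h : PairIso p n K c c') : PairIso p n K c' c := by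
  obtain ⟨φ, v, g, hv, hφ⟩ := h
  obtain ⟨u, rfl⟩ := hv
  refine ⟨φ.symm, φ.symm ↑u⁻¹, -(φ.symm (↑u⁻¹ * g)), (Units.isUnit u⁻¹).map φ.symm, ?_⟩
  have ha : ser p n K c =
      φ.symm ((u : MvPowerSeries (Fin n) K) ^ p * ser p n K c' + g ^ p) := by
    rw [← hφ, AlgEquiv.symm_apply_apply]
  have h1 : φ.symm ↑u⁻¹ * φ.symm ↑u = 1 := by
    rw [← map_mul, Units.inv_mul, map_one]
  have h2 : (φ.symm ↑u⁻¹ * φ.symm ↑u) ^ p = 1 := by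
    rw [h1, one_pow]
  have h3 := neg_pow_p hp (φ.symm ↑u⁻¹ * φ.symm g)
  rw [ha, map_add, map_mul, map_pow, map_pow, map_mul]
  linear_combination (-(φ.symm (ser p n K c'))) * h2 - h3

/-- `PairIso` is transitive: `φ₂ (φ₁ a) = (φ₂ v₁ · v₂)^p a'' + (φ₂ v₁ · g₂ + φ₂ g₁)^p`.
[folklore] -/
theorem pairIso_trans (hp : p.Prime) [CharP K p] {c c' c'' : (Fin n → ℕ) → K}
    (h₁ : PairIso p n K c c') (h₂ : PairIso p n K c' c'') : PairIso p n K c c'' := by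
  obtain ⟨φ₁, v₁, g₁, hv₁, hφ₁⟩ := h₁
  obtain ⟨φ₂, v₂, g₂, hv₂, hφ₂⟩ := h₂
  refine ⟨φ₁.trans φ₂, φ₂ v₁ * v₂, φ₂ v₁ * g₂ + φ₂ g₁, (hv₁.map φ₂).mul hv₂, ?_⟩
  rw [AlgEquiv.trans_apply, hφ₁, map_add, map_mul, map_pow, map_pow, hφ₂, add_pow_p hp]
  ring

/-! ### The Jacobian ideal under automorphisms -/

/-- The route's `pd` is the tree's derivation `MvPowerSeries.pderiv` (same coefficient formula up
to `Nat.cast_succ`). [folklore] -/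
theorem pd_eq_pderiv (i : Fin n) (f : MvPowerSeries (Fin n) K) :
    pd n K i f = MvPowerSeries.pderiv i f := by
  ext A
  rw [MvPowerSeries.coeff_pderiv, ← Nat.cast_succ]
  rfl

/-- `jac c` is the span of the tree's partial derivatives of `ser c`. [folklore] -/
theorem jac_eq (p : ℕ) (c : (Fin n → ℕ) → K) :
    jac p n K c =
      Ideal.span (Set.range fun i => MvPowerSeries.pderiv i (ser p n K c)) := by
  unfold jac
  simp_rw [pd_eq_pderiv]

/-- Chain rule for a `K`-algebra endomorphism `φ` of `K⟦u⟧`: every `∂ᵢ (φ f)` lies in the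
extension of the Jacobian ideal `(∂₁ f, …, ∂ₙ f)` along `φ` (`φ f = f(φ u)` and
`∂ᵢ (f(φ u)) = Σₜ (∂ₜ f)(φ u) · ∂ᵢ (φ uₜ)`). [folklore] -/
theorem pderiv_algHom_mem (φ : MvPowerSeries (Fin n) K →ₐ[K] MvPowerSeries (Fin n) K)
    (f : MvPowerSeries (Fin n) K) (i : Fin n) :
    MvPowerSeries.pderiv i (φ f) ∈
      (Ideal.span (Set.range fun t => MvPowerSeries.pderiv t f)).map
        (φ : MvPowerSeries (Fin n) K →+* MvPowerSeries (Fin n) K) := by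
  rw [algHom_apply_eq_subst φ f, MvPowerSeries.pderiv_subst (constantCoeff_algHom_X φ) i f]
  refine Ideal.sum_mem _ fun t _ => Ideal.mul_mem_right _ _ ?_
  rw [← algHom_apply_eq_subst φ]
  exact Ideal.mem_map_of_mem _ (Ideal.subset_span ⟨t, rfl⟩)

/-- For a `K`-algebra automorphism `φ` of `K⟦u⟧`: `(∂₁ f, …, ∂ₙ f).map φ = (∂₁ (φ f), …, ∂ₙ (φ f))`.
[folklore] -/
theorem span_pderiv_map (φ : MvPowerSeries (Fin n) K ≃ₐ[K] MvPowerSeries (Fin n) K)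
    (f : MvPowerSeries (Fin n) K) :
    (Ideal.span (Set.range fun t => MvPowerSeries.pderiv t f)).map
        (φ : MvPowerSeries (Fin n) K →+* MvPowerSeries (Fin n) K) =
      Ideal.span (Set.range fun i => MvPowerSeries.pderiv i (φ f)) := by
  apply le_antisymm
  · rw [Ideal.map_le_iff_le_comap, Ideal.span_le]
    rintro _ ⟨t, rfl⟩
    rw [SetLike.mem_coe, Ideal.mem_comap]
    -- `∂ₜ f = ∂ₜ (φ⁻¹ (φ f)) ∈ (span ∂(φ f)).map φ⁻¹`, then apply `φ`
    have h := pderiv_algHom_mem (φ.symm : MvPowerSeries (Fin n) K →ₐ[K] MvPowerSeries (Fin n) K)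
      (φ f) t
    rw [AlgEquiv.coe_toAlgHom, AlgEquiv.toAlgHom_toRingHom, AlgEquiv.symm_apply_apply] at h
    have h' := Ideal.mem_map_of_mem (φ : MvPowerSeries (Fin n) K →+* MvPowerSeries (Fin n) K) h
    have hcomp : (φ : MvPowerSeries (Fin n) K →+* MvPowerSeries (Fin n) K).comp
        (φ.symm : MvPowerSeries (Fin n) K →+* MvPowerSeries (Fin n) K) = RingHom.id _ :=
      RingHom.ext fun x => by simp
    rwa [Ideal.map_map, hcomp, Ideal.map_id] at h'
  · rw [Ideal.span_le]
    rintro _ ⟨i, rfl⟩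
    exact pderiv_algHom_mem (φ : MvPowerSeries (Fin n) K →ₐ[K] MvPowerSeries (Fin n) K) f i

/-- `∂ᵢ (v^p a + g^p) = v^p ∂ᵢ a` in characteristic `p` (`∂ᵢ` is a derivation, `p = 0`).
[folklore] -/
theorem pderiv_frobenius_form (p : ℕ) [CharP K p] (i : Fin n)
    (v a g : MvPowerSeries (Fin n) K) :
    MvPowerSeries.pderiv i (v ^ p * a + g ^ p) = v ^ p * MvPowerSeries.pderiv i a := by
  haveI := charP_series (n := n) (K := K) p
  simp only [map_add, Derivation.leibniz, Derivation.leibniz_pow, smul_eq_mul, nsmul_eq_mul,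
    CharP.cast_eq_zero, zero_mul, mul_zero, add_zero]

/-- Scaling the generators by a unit does not change the span. [folklore] -/
theorem span_range_unit_mul {ι : Type} {u : MvPowerSeries (Fin n) K} (hu : IsUnit u)
    (f : ι → MvPowerSeries (Fin n) K) :
    Ideal.span (Set.range fun i => u * f i) = Ideal.span (Set.range f) := by
  apply le_antisymm
  · rw [Ideal.span_le]
    rintro _ ⟨i, rfl⟩
    exact Ideal.mul_mem_left _ _ (Ideal.subset_span ⟨i, rfl⟩)
  · rw [Ideal.span_le]
    rintro _ ⟨i, rfl⟩
    obtain ⟨w, rfl⟩ := hu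
    have : f i = ↑w⁻¹ * (↑w * f i) := by rw [← mul_assoc, Units.inv_mul, one_mul]
    rw [SetLike.mem_coe, this]
    exact Ideal.mul_mem_left _ _ (Ideal.subset_span ⟨i, rfl⟩)

/-- **Transport of the Jacobian ideal**: `φ (ser c) = v^p ser c' + g^p` with `v` a unit gives
`(jac c).map φ = jac c'`. [folklore] -/
theorem jac_map [CharP K p] {c c' : (Fin n → ℕ) → K}
    (φ : MvPowerSeries (Fin n) K ≃ₐ[K] MvPowerSeries (Fin n) K) {v g : MvPowerSeries (Fin n) K}
    (hv : IsUnit v) (h : φ (ser p n K c) = v ^ p * ser p n K c' + g ^ p) :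
    (jac p n K c).map (φ : MvPowerSeries (Fin n) K →+* MvPowerSeries (Fin n) K) =
      jac p n K c' := by
  rw [jac_eq, jac_eq, span_pderiv_map, h]
  simp_rw [pderiv_frobenius_form p]
  exact span_range_unit_mul (hv.pow p) _

/-! ### `Isol` and `JacPow` are invariant -/

/-- `Isol` passes along a pair isomorphism (`R ⧸ jac c ≃ₐ[K] R ⧸ jac c'`). [folklore] -/
theorem isol_of_pairIso [CharP K p] {c c' : (Fin n → ℕ) → K}
    (h : PairIso p n K c c') (hc : Isol p n K c) : Isol p n K c' := by
  obtain ⟨φ, v, g, hv, hφ⟩ := h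
  unfold Isol at hc ⊢
  exact Module.Finite.equiv
    (Ideal.quotientEquivAlg (jac p n K c) (jac p n K c') φ (jac_map φ hv hφ).symm).toLinearEquiv

/-- The Loewy bound `𝔪^β ≤ jac` passes along a pair isomorphism (`φ 𝔪 = 𝔪`). [folklore] -/
theorem jacPow_of_pairIso [CharP K p] {c c' : (Fin n → ℕ) → K}
    (h : PairIso p n K c c') (β : ℕ) (hc : JacPow p n K β c) : JacPow p n K β c' := by
  obtain ⟨φ, v, g, hv, hφ⟩ := h
  unfold JacPow at hc ⊢
  have := Ideal.map_mono (f := (φ : MvPowerSeries (Fin n) K →+* MvPowerSeries (Fin n) K)) hc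
  rwa [jac_map φ hv hφ, Ideal.map_pow,
    IsLocalRing.map_maximalIdeal_of_surjective _ φ.surjective] at this

/-! ### `MultP` is invariant -/

/-- Coefficients of the cleaned series. [folklore] -/
theorem coeff_ser (p : ℕ) (c : (Fin n → ℕ) → K) (e : Fin n →₀ ℕ) :
    coeff e (ser p n K c) = clean p n K c ⇑e :=
  rfl

/-- The cleaned series has no `p`-th-power monomials. [folklore] -/
theorem coeff_ser_of_dvd (c : (Fin n → ℕ) → K) {e : Fin n →₀ ℕ} (h : ∀ j, p ∣ e j) :
    coeff e (ser p n K c) = 0 := by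
  rw [coeff_ser]
  unfold clean
  rw [if_pos h]

/-- `MultP c` in terms of the series `ser c`: non-zero, with no coefficient of degree `< p`.
[folklore] -/
theorem multP_iff (c : (Fin n → ℕ) → K) :
    MultP p n K c ↔
      ser p n K c ≠ 0 ∧ ∀ e : Fin n →₀ ℕ, coeff e (ser p n K c) ≠ 0 → p ≤ e.degree := by
  constructor
  · rintro ⟨⟨A, hA⟩, hmin⟩
    refine ⟨fun h0 => hA ?_, fun e he => ?_⟩
    · have := congrArg (coeff (Finsupp.equivFunOnFinite.symm A)) h0
      rwa [coeff_ser, map_zero, Finsupp.coe_equivFunOnFinite_symm] at this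
    · rw [Finsupp.degree_eq_sum]
      exact hmin (⇑e) he
  · rintro ⟨h0, hmin⟩
    refine ⟨?_, fun A hA => ?_⟩
    · by_contra hex
      apply h0
      ext e
      rw [coeff_ser, map_zero]
      exact not_not.mp fun h => hex ⟨⇑e, h⟩
    · have := hmin (Finsupp.equivFunOnFinite.symm A)
        (by rwa [coeff_ser, Finsupp.coe_equivFunOnFinite_symm])
      simpa [Finsupp.degree_eq_sum] using this

/-- A `p`-th power has no monomial with an exponent not divisible by `p`. [folklore] -/
theorem coeff_pow_p_eq_zero (hp : p.Prime) [CharP K p] (g : MvPowerSeries (Fin n) K)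
    {e : Fin n →₀ ℕ} {j : Fin n} (hj : ¬ p ∣ e j) : coeff e (g ^ p) = 0 := by
  haveI := Fact.mk hp
  rw [coeff_pow_char p g e, coeff_expand_of_not_dvd p hp.ne_zero g hj, zero_pow hp.ne_zero]

/-- A cleaned series which is a `p`-th power vanishes. [folklore] -/
theorem ser_eq_zero_of_eq_pow (hp : p.Prime) [CharP K p] (c : (Fin n → ℕ) → K)
    {g : MvPowerSeries (Fin n) K} (h : ser p n K c = g ^ p) : ser p n K c = 0 := by
  ext e
  rw [map_zero]
  by_cases hd : ∀ j, p ∣ e j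
  · exact coeff_ser_of_dvd c hd
  · obtain ⟨j, hj⟩ := not_forall.mp hd
    rw [h]
    exact coeff_pow_p_eq_zero hp g hj

/-- Lowest-order coefficient of a product: if `f` has order `|e|`, then
`coeff e (v f) = v(0) · coeff e f`. [folklore] -/
theorem coeff_mul_of_order_eq (v f : MvPowerSeries (Fin n) K) {e : Fin n →₀ ℕ}
    (he : f.order = e.degree) : coeff e (v * f) = constantCoeff v * coeff e f := by
  rw [coeff_mul, Finset.sum_eq_single (0, e)]
  · rw [coeff_zero_eq_constantCoeff_apply]
  · rintro ⟨x, y⟩ hxy hne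
    have hxy' : x + y = e := Finset.HasAntidiagonal.mem_antidiagonal.mp hxy
    have hx : x ≠ 0 := by
      rintro rfl
      rw [zero_add] at hxy'
      exact hne (by rw [hxy'])
    apply mul_eq_zero_of_right
    apply coeff_of_lt_order
    show ((Finsupp.degree y : ℕ) : ℕ∞) < f.order
    rw [he, Nat.cast_lt, ← hxy', map_add]
    have := (Finsupp.degree_eq_zero_iff x).not.mpr hx
    omega
  · intro h
    exact absurd (Finset.HasAntidiagonal.mem_antidiagonal.mpr (zero_add e)) h

/-- `MultP` passes along a pair isomorphism. [folklore] -/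
theorem multP_of_pairIso (hp : p.Prime) [CharP K p] {c c' : (Fin n → ℕ) → K}
    (h : PairIso p n K c c') (hc : MultP p n K c) : MultP p n K c' := by
  rw [multP_iff] at hc ⊢
  obtain ⟨ha0, hmin⟩ := hc
  obtain ⟨φ, v, g, hv, hφ⟩ := h
  -- (1) `ser c' ≠ 0`: otherwise `ser c = (φ⁻¹ g)^p` is a cleaned `p`-th power
  have ha'0 : ser p n K c' ≠ 0 := by
    intro h0
    apply ha0
    refine ser_eq_zero_of_eq_pow hp c (g := φ.symm g) ?_
    apply φ.injective
    rw [map_pow, AlgEquiv.apply_symm_apply, hφ, h0, mul_zero, zero_add]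
  refine ⟨ha'0, ?_⟩
  -- (2) the order of `ser c'` is attained at some `e₀`; suppose `|e₀| < p`
  obtain ⟨e₀, he₀, horder⟩ := exists_coeff_ne_zero_and_order (ne_zero_iff_order_finite.mp ha'0)
  by_cases hdeg : p ≤ e₀.degree
  · intro e he
    have hle := order_le he
    rw [← horder, Nat.cast_le] at hle
    exact le_trans hdeg hle
  · exfalso
    have hlt : e₀.degree < p := not_le.mp hdeg
    -- `φ (ser c) ∈ 𝔪^p` has no coefficient at `e₀`
    have h1 : coeff e₀ (φ (ser p n K c)) = 0 := by
      have hmem : ser p n K c ∈ IsLocalRing.maximalIdeal (MvPowerSeries (Fin n) K) ^ p :=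
        mem_maximalIdeal_pow_of_coeff_eq_zero fun e he =>
          not_not.mp fun hne => absurd (hmin e hne) (not_le.mpr he)
      exact coeff_eq_zero_of_mem_maximalIdeal_pow
        (algHom_apply_mem_maximalIdeal_pow (φ : MvPowerSeries (Fin n) K →ₐ[K] _) hmem) hlt
    -- `g^p` has no coefficient at `e₀` (some exponent of `e₀` is prime to `p`, `ser c'` is cleaned)
    have h2 : coeff e₀ (g ^ p) = 0 := by
      obtain ⟨j, hj⟩ := not_forall.mp fun hall => he₀ (coeff_ser_of_dvd c' hall)
      exact coeff_pow_p_eq_zero hp g hj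
    -- `v^p ser c'` has coefficient `v(0)^p coeff e₀ (ser c') ≠ 0` at `e₀`
    have h3 :
        coeff e₀ (v ^ p * ser p n K c') = constantCoeff v ^ p * coeff e₀ (ser p n K c') := by
      rw [coeff_mul_of_order_eq _ _ horder.symm, map_pow]
    rw [hφ, map_add, h2, add_zero, h3] at h1
    refine mul_ne_zero (pow_ne_zero _ ?_) he₀ h1
    exact (isUnit_iff_constantCoeff.mp hv).ne_zero

end PairIsoKitProof

open PairIsoKitProof in
/-- **`PairIsoKit`** (stub `stub_pairIsoKit` of line `chart-factorization`, crux
`ClosingReduction`): over a field of characteristic `p`, `PairIso` is symmetric and transitive,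
and `Isol`, `MultP`, `JacPow β` are `PairIso`-invariant. [folklore] -/
theorem stub_pairIsoKit : PairIsoKit := by
  intro p hp n _hn K _ _
  refine ⟨fun c c' h => pairIso_symm hp h, fun c c' c'' h₁ h₂ => pairIso_trans hp h₁ h₂,
    fun c c' h => ⟨?_, ?_, fun β => ?_⟩⟩
  · exact ⟨isol_of_pairIso h, isol_of_pairIso (pairIso_symm hp h)⟩
  · exact ⟨multP_of_pairIso hp h, multP_of_pairIso hp (pairIso_symm hp h)⟩
  · exact ⟨jacPow_of_pairIso h β, jacPow_of_pairIso (pairIso_symm hp h) β⟩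

end Summit.ResolutionOfSingularities.ResolutionOfSingularities.Theorems.FrobeniusClosing

end
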